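import Summits.AnomalousDissipation.AnomalousDissipation.Theorems.SolenoidalFractalHomogenisationLagrangianStepPropagatorClass
import Literature.Analysis.FunctionSpaces.TorusFourierCalculus
import HarnessLib

/-!
# K1L_D (stmt-AnomalousDissipation-27980), line «onelevel-design», brick Z4♭: the SINE PHASE — window maps that commute with one grid
# translation treat the `sin·p` single-mode datum exactly like the `cos·p` one at the mode `ℓ` (helper; `--supports … --as helper`; lead g4)

Finding F-lead-g4-1 (memo L8): the slow-vector clause (V) `SlowVectorClauseF` is typed for the cosine data `Re(e_ℓ)•p` only, while the flat core
Z4♭ of the bilinear cut needs every real slow mode, i.e. also `Im(e_ℓ)•p`.  No second clause is needed: for ANY two linear window maps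
`U, T : V2 →L[ℝ] V2` commuting with the translation `τ_h` by ONE torus point `h` with `Im e_ℓ(h) ≠ 0` (for the cell propagator: a grid point
`h = z/n`, `…PropagatorTranslate.map_translate_eq`; such `z` exists as soon as `n ∤ 2(ℓ·z)` for some `z`, e.g. `n > 2|ℓ|₁`),
* `sinMode_eq` — `Im(e_ℓ)•p = (Im e_ℓ(h))⁻¹ • (Re e_ℓ(h) • Re(e_ℓ)•p − (Re(e_ℓ)•p)∘(· + h))` (addition theorem);
* **`norm_fcoeff_sub_sinMode_eq`** — `‖𝓕(U x_s − T x_s)(ℓ)‖ = ‖𝓕(U x_c − T x_c)(ℓ)‖` for `x_c = toLp (Re(e_ℓ)•p)`, `x_s = toLp (Im(e_ℓ)•p)`: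
  the error coefficient of the sine datum at `ℓ` is `−i` times that of the cosine datum (`𝓕(τ_h v)(ℓ) = e_ℓ(h)•𝓕v(ℓ)`, and
  `(Re u − u)/Im u = −i` for `u = e_ℓ(h)`).
So every modewise bound proved for cosine data (e.g. `…CellTimeModewise`) holds verbatim for sine data.
NOT a proof of Z4♭, of any registered stub, of the crux, or of AD; rung F-D1.A0.
-/

set_option linter.dupNamespace false  -- the summit-side namespace `Summit.AnomalousDissipation.AnomalousDissipation.…` repeats a component by design (D-0017)

noncomputable section

namespace Summit.AnomalousDissipation.AnomalousDissipation.Theorems.SolenoidalFractalHomogenisation.LagrangianStep.PropagatorSymm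

open Literature.Analysis Literature.Analysis.FluidPDE Literature.Analysis.FluidPDE.Torus Literature.Analysis.FunctionSpaces
open MeasureTheory Set Filter UnitAddTorus Function
open scoped ENNReal NNReal InnerProductSpace
open OneLevelSplit
open Summit.AnomalousDissipation.AnomalousDissipation.Theorems.SolenoidalFractalHomogenisation.RealisedQuasiStaticCellLaw
  (memLp_two_of_memSobolev_one_complexify memSobolev_one_singleMode)

/-- The cosine single-mode datum is in `L²`. -/
theorem memLp_cosMode (ℓ : Fin 3 → ℤ) (p : EuclideanSpace ℝ (Fin 3)) :
    MemLp (fun x : UnitAddTorus (Fin 3) => (mFourier ℓ x).re • p) 2 volume :=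
  memLp_two_of_memSobolev_one_complexify (memSobolev_one_singleMode ℓ p)

/-- The sine single-mode datum is in `L²` (it is continuous on a compact space; we get it from the cosine one by the addition theorem below,
but the direct route is shorter: bounded measurable on a finite measure space). -/
theorem memLp_sinMode (ℓ : Fin 3 → ℤ) (p : EuclideanSpace ℝ (Fin 3)) :
    MemLp (fun x : UnitAddTorus (Fin 3) => (mFourier ℓ x).im • p) 2 volume := by
  have hc : Continuous fun x : UnitAddTorus (Fin 3) => (mFourier ℓ x).im • p :=
    (Complex.continuous_im.comp (mFourier ℓ).continuous).smul continuous_const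
  refine MemLp.of_bound hc.aestronglyMeasurable ‖p‖ (ae_of_all _ fun x => ?_)
  have h1 : |(mFourier ℓ x).im| ≤ 1 :=
    (Complex.abs_im_le_norm _).trans ((ContinuousMap.norm_coe_le_norm (mFourier ℓ) x).trans (by rw [mFourier_norm]))
  rw [norm_smul, Real.norm_eq_abs]
  nlinarith [norm_nonneg p, abs_nonneg ((mFourier ℓ x).im)]

/-- **Addition theorem, rearranged**: with `u = e_ℓ(h)`, `Im u ≠ 0`:
`Im(e_ℓ x)•p = (Im u)⁻¹ • (Re u • Re(e_ℓ x)•p − Re(e_ℓ (x + h))•p)`. -/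
theorem sinMode_eq (ℓ : Fin 3 → ℤ) (p : EuclideanSpace ℝ (Fin 3)) {h : UnitAddTorus (Fin 3)} (him : (mFourier ℓ h).im ≠ 0) :
    (fun x : UnitAddTorus (Fin 3) => (mFourier ℓ x).im • p)
      = fun x => ((mFourier ℓ h).im)⁻¹ • (((mFourier ℓ h).re) • ((mFourier ℓ x).re • p) - (mFourier ℓ (x + h)).re • p) := by
  funext x
  rw [Torus.mFourier_apply_add, Complex.mul_re]
  ext i
  simp only [PiLp.smul_apply, PiLp.sub_apply, smul_eq_mul]
  field_simp
  ring

variable (U T : V2 →L[ℝ] V2) (h : UnitAddTorus (Fin 3))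
  (hU : ∀ x : V2, U (Lp.compMeasurePreserving (fun y : UnitAddTorus (Fin 3) => y + h) (measurePreserving_add_right volume h) x)
    = Lp.compMeasurePreserving (fun y : UnitAddTorus (Fin 3) => y + h) (measurePreserving_add_right volume h) (U x))
  (hT : ∀ x : V2, T (Lp.compMeasurePreserving (fun y : UnitAddTorus (Fin 3) => y + h) (measurePreserving_add_right volume h) x)
    = Lp.compMeasurePreserving (fun y : UnitAddTorus (Fin 3) => y + h) (measurePreserving_add_right volume h) (T x))

include hU hT

/-- **The sine phase costs nothing at the mode `ℓ`.**  For linear window maps commuting with `τ_h`, `Im e_ℓ(h) ≠ 0`: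
`‖𝓕(U x_s − T x_s)(ℓ)‖ = ‖𝓕(U x_c − T x_c)(ℓ)‖`. -/
theorem norm_fcoeff_sub_sinMode_eq (ℓ : Fin 3 → ℤ) (p : EuclideanSpace ℝ (Fin 3)) (him : (mFourier ℓ h).im ≠ 0) :
    ‖mFourierCoeff (EuclideanSpace.complexify ∘ ⇑(U ((memLp_sinMode ℓ p).toLp _) - T ((memLp_sinMode ℓ p).toLp _))) ℓ‖
      = ‖mFourierCoeff (EuclideanSpace.complexify ∘ ⇑(U ((memLp_cosMode ℓ p).toLp _) - T ((memLp_cosMode ℓ p).toLp _))) ℓ‖ := by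
  set u : ℂ := mFourier ℓ h with hu_def
  set xc : V2 := (memLp_cosMode ℓ p).toLp _ with hxc
  -- the sine datum as a combination of the cosine datum and its translate
  have hch : MemLp (fun x : UnitAddTorus (Fin 3) => (mFourier ℓ (x + h)).re • p) 2 volume :=
    (memLp_cosMode ℓ p).comp_measurePreserving (measurePreserving_add_right volume h)
  have htr : Lp.compMeasurePreserving (fun y : UnitAddTorus (Fin 3) => y + h) (measurePreserving_add_right volume h) xc = hch.toLp _ := by
    rw [hxc, translate_toLp]; rfl
  have hxs : (memLp_sinMode ℓ p).toLp _ = (u.im)⁻¹ • ((u.re) • xc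
      - Lp.compMeasurePreserving (fun y : UnitAddTorus (Fin 3) => y + h) (measurePreserving_add_right volume h) xc) := by
    rw [htr, hxc, ← MemLp.toLp_const_smul, ← MemLp.toLp_sub, ← MemLp.toLp_const_smul]
    refine MemLp.toLp_congr _ _ (Filter.Eventually.of_forall fun x => ?_)
    have e1 := congrFun (sinMode_eq ℓ p him) x
    simp only [Pi.smul_apply, Pi.sub_apply] at e1 ⊢
    exact e1
  -- linearity and commutation
  have hlin : U ((memLp_sinMode ℓ p).toLp _) - T ((memLp_sinMode ℓ p).toLp _)
      = (u.im)⁻¹ • ((u.re) • (U xc - T xc)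
        - Lp.compMeasurePreserving (fun y : UnitAddTorus (Fin 3) => y + h) (measurePreserving_add_right volume h) (U xc - T xc)) := by
    rw [hxs, map_smul, map_smul, map_sub, map_sub, map_smul, map_smul, hU, hT, map_sub]
    module
  -- coefficients at `ℓ`
  rw [hlin, fcoeff_smul, fcoeff_sub, fcoeff_smul, fcoeff_translate, ← sub_smul, smul_smul, norm_smul]
  have hfac : ((u.im)⁻¹ : ℝ) * ((u.re : ℂ) - u) = -Complex.I := by
    apply Complex.ext
    · simp
    · simp [him]
  rw [hfac, norm_neg, Complex.norm_I, one_mul]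

end Summit.AnomalousDissipation.AnomalousDissipation.Theorems.SolenoidalFractalHomogenisation.LagrangianStep.PropagatorSymm

end
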